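import Literature.Computability.Cryptography.RegevStageCopies
import Literature.Computability.Cryptography.RegevReductionFinal
import HarnessLib

/-!
# Regev 2009, Theorem 1.1 (`LWE ⇒_Q SIVP/GapSVP`): census of the formalisation, the two machine-level
# residuals as named facts, and the discharge of pqc.S19 from them

Topic `Computability/Cryptography` (family `pqc`). O. Regev, *On lattices, learning with errors, random
linear codes, and cryptography*, J. ACM 56 (2009), art. 34 (author's version arXiv:2401.03703, whose
page numbers are quoted), Theorem 1.1 (labelled "Theorem 1.1 (Informal)" in the paper, p. 3; the formal
content is Theorem 3.1 + Lemmas 3.17, 3.20 + §4): *"Let `n, p` be integers and `α ∈ (0,1)` such that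
`αp > 2√n`. If there exists an efficient algorithm that solves `LWE_{p,Ψ̄_α}` then there exists an
efficient quantum algorithm that approximates the decision version of the shortest vector problem
(`GapSVP`) and the shortest independent vectors problem (`SIVP`) to within `Õ(n/α)` in the worst case."*
The two target statements are the named facts (pqc.S19, `LWEHardness.lean`)
`Literature.Computability.Cryptography.regev_lwe_to_sivp_quantum q α m` and
`Literature.Computability.Cryptography.regev_lwe_to_gapSVP_quantum q α m`: hypotheses `q, m`
polynomially bounded, `(q, α, m)` computable from `1ⁿ` in polynomial time (`IsPolyTimeParams`),
`0 < α < 1` and `2√n < α q` eventually, and ONE uniform poly-time quantum family solving search-`LWE`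
on the average from `m n` samples of `A_{s,Ψ̄_α}` with probability `≥ 2/3`; conclusions: a factor
`γ ≥ 1` with `γ = Õ(n/α)` (`IsSoftBigO`) and a uniform poly-time quantum family solving `SIVP_γ` on every
nonsingular integer lattice (resp. deciding the promise problem `GapSVP_γ` with error `≤ 1/3`),
eventually in the dimension.

## What this file does

It records, as TWO NAMED FACTS stated verbatim as the hypotheses of proved theorems of the tree, what is
NOT yet constructed at the machine level (uniform families of Clifford+T circuits), and PROVES both
target statements from them:

* `regev2009_thm_3_1_oneSampleStage q α` (**residual A**) — the hypothesis `hQ` of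
  `regev_lwe_to_sivp_quantum_of_oneCopy` (`RegevStageCopies.lean`): ONE uniform family `Q`, the
  *one-sample stage machine* of the proof of Theorem 3.1 (p. 15), with (CODE) an output format,
  (BOOT₁) Lemma 3.2 in machine form for one sample, (STEP₁) Lemma 3.3 (= Lemma 3.4, classical, using
  the `LWE` oracle, followed by Lemma 3.14, the only quantum step) in machine form for one sample GIVEN
  the previous samples, with a failure bound negligible on average over ideal samples, (PASS₁) identity
  at padding stages;
* `regev2009_lemma_3_20_machine` (**residual B**) — the hypothesis `hL` of
  `regev_lwe_to_gapSVP_quantum_of_thm31_of_lemma320` (`RegevReductionFinal.lean`): Lemma 3.20 in machine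
  form (a `DGS_{√n γ/λ₁(L*)}` sampler yields a quantum `GapCVP′_{100√n γ}` decider);
* `regev2009_thm_3_1_dgs_of_oneSampleStage` — Theorem 3.1 in its printed form (an efficient quantum
  `DGS_{√(2n)·η_ε(L)/α}` sampler from a worst-case search-`LWE_{q,Ψ̄_α}` solver with exponentially small
  failure), PROVED from residual A;
* `regev_lwe_to_sivp_quantum_holds_of (h : residual A)` and
  `regev_lwe_to_gapSVP_quantum_holds_of (h : residual A) (hL : residual B)` — pqc.S19, both forms.

Trust base of the two `_holds_of` theorems: the kernel axioms `propext`, `Classical.choice`,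
`Quot.sound` and NOTHING else (no `sorry`, no named fact other than the displayed hypotheses).

## Census of the formalisation (tree of 2026-08-18; 65 files under `Computability/Cryptography/` and
## 26 under `Algebra/EuclideanLattices/` cite [Regev2009], 33 491 lines)

Printed item (arXiv:2401.03703) → tree declaration(s) → status.

* Thm 1.1, SIVP form → `regev_lwe_to_sivp_quantum` (fact, pqc.S19) → PROVED FROM RESIDUAL A (this file).
* Thm 1.1, GapSVP form → `regev_lwe_to_gapSVP_quantum` (fact, pqc.S19) → PROVED FROM RESIDUALS A + B.
* §2 p. 12 with Lemma 4.1 (proof: the random shift `s ↦ s + t`) and the amplification `2/3 ↦ 1 - 2^{-cn}`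
  (average-case `LWE` solver ⇒ worst-case solver) → `Regev2009.searchLWE_worstCase_of_avgCase`
  (`LWEAmplification.lean`, machine level) → PROVED.
* Thm 3.1 (`LWE ⇒ DGS_{√(2n)η_ε/α}`), the iteration over `3n` levels `r_i = r·(αp/√n)^i` with `n^c`
  samples per level (p. 15) → `Regev2009.thm_3_1_machine_of_stages` (`RegevMainTheoremStages.lean`), the
  chain of stages `ChainCompose.exists_chainFamily` (`QuantumComplexity/ChainComposeUniform.lean`), the
  separation of the chain from the single stage `Regev2009.thm_3_1_stage_of_kernelLaws`
  (`RegevStageKernelLaws.lean`), the `N = n^c` parallel copies `Regev2009.StageCopies.kernelLaws_of_oneCopy`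
  (`RegevStageCopies.lean`) → PROVED down to residual A; `regev2009_thm_3_1_dgs_of_oneSampleStage` here.
* Lemma 3.2 (bootstrapping: LLL + a rounded continuous Gaussian is `2^{-Ω(n)}`-close to `D_{L,r}` for
  `r > 2^{2n} λ_n(L)`) → law level `Regev2009.tvDist_roundedGaussian_le_of_forall_norm_le`,
  `tvDist_roundedGaussian_discreteGaussian_le` (`RegevBootstrap.lean`), LLL bound
  `norm_le_two_pow_mul_successiveMinimum` (`RegevDigitRounds.lean`) → PROVED; the uniform family running
  it = clause (BOOT₁) of residual A → RESIDUAL.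
* Lemma 3.3 (the iterative step) = Lemma 3.4 + Lemma 3.14 → clause (STEP₁) of residual A → RESIDUAL at
  the machine level; its mathematics:
  - Lemma 3.4 (`LWE` oracle + `poly(n)` samples of `D_{L,r}` ⇒ `CVP_{L*, αp/(√2 r)}` solver), the whole
    classical experiment → `Regev2009.regevBDD`, `Regev2009.toReal_regevBDD_ne_le`
    (`RegevBDDToLWEIdealised.lean`) → PROVED (law level); the oracle-answer interface of the `CVP`
    subroutine `Regev2009.CVPOracle.answerFn` (`RegevCVPOracleFn.lean`) → PROVED;
  - Lemma 3.5 (`CVP` from `CVP^{(p)}` by digits) → `RegevDigitRecursion.lean`, `RegevDigitRounds.lean` → PROVED;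
  - Lemma 3.6 (verification of a candidate `s'`) → `toReal_accept_of_ne_le_exp`,
    `toReal_reject_self_le_exp` (`RegevVerificationTest.lean`, `RegevVerificationFourier.lean`) → PROVED;
  - Lemma 3.7 with Lemma 3.11 (solving `LWE_{p,Ψ_β}` for unknown `β ≤ α` from an `LWE_{p,Ψ_α}` oracle)
    → `RegevLWESolveIdealised.lean`, `RegevLWESolveKernel.lean`, `toReal_firstAccepted_ne_le_gaussian`
    (`RegevLWESolveGaussian.lean`) → PROVED;
  - Claims 3.8–3.10, Cor. 3.10 (Gaussian facts, `Ψ̄` vs `Ψ`) → `LWENoise*.lean`, `RegevBDDIntegerNoise.lean`,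
    `RegevBDDToLWESample*.lean`, `SmoothingParameterBounds.lean` → PROVED;
  - Lemma 3.12, Claim 3.13 (the 2023-corrected proof), Lemma 3.14 (the quantum step: `CVP_{L*}` oracle ⇒
    a sample of `D_{L,√n/(√2 d)}`) → `claim_3_13` (`RegevQuantumApprox.lean`), `claim_3_13_coords`
    (`RegevPeriodicGaussianState.lean`), `lemma_3_14_ideal_of_basis` (`RegevQuantumPart.lean`), the law of
    the measured output of the three-stage machine `QPart.law_bound_of_basis` (`RegevQuantumPartLaw.lean`,
    with `RegevQuantumPartStates/Fibres/Data/Fourier.lean`), the Gaussian state on a box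
    (`RegevBoxGaussianState.lean`, `RegevQFTPeriodicGaussian.lean`) → PROVED (law/state level); the
    coherent classical stage of the sampler (`Y ⊕= branch`, `S ⊕= residues`, oracle, uncompute, oracle)
    `Regev2009.SamplerClassical.kappa_spec`, `isBasisMap_stageMat` (`RegevSamplerClassical.lean`, with
    `RegevSampler{Arith,ArithFP,Formats,Params,Words,WordFns}.lean`, `RegevNoiseWidths.lean`) → PROVED;
    the assembly of these pieces into ONE uniform family with the (STEP₁) law → RESIDUAL (A).
* Lemma 3.15 (no short vectors near hyperplanes) → `lemma_3_15` (`RegevHyperplaneEscape.lean`) → PROVED.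
* Lemmas 3.16–3.17 (`DGS ⇒ GIVP/SIVP_{2√(2n) φ/λ_n}`), machine level →
  `Regev2009.GIVPMachine.regev_dgs_to_givp_quantum` (`RegevGIVPMachine.lean`, `RegevGIVPPost.lean`,
  `RegevGIVPQuery.lean`, `MRGIVPLoop.lean`, `GapSVPFromGIVP.lean`) → PROVED.
* §3.3, [GMSS99] (`GapSVP_γ ≤ GapCVP′_γ`, quantum machine form) → `Regev2009.gmss_gapSVP_of_gapCVP'_quantum`
  (`RegevReductionTT.lean`; Cook-closure form `RegevReductionGMSS.lean`) → PROVED.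
* Lemma 3.20 (`GapCVP′_{100√n γ} ≤ DGS_{√n γ/λ₁(L*)}` via the Aharonov–Regev verifier) → the NO-case
  analysis `le_measureReal_accepts_certOf_of_gapCVP'_no` (`ARVerifierRandomWitness.lean`), the verifier
  machine `ARVerifierMachine*.lean`, the dual query `RegevDualQuery.lean`, `RegevDualQueryMachine.lean`,
  the laws of the `N` decoded samples `RegevReductionDGSLaws.lean`, `RegevReductionDGSBlocks.lean` →
  PROVED (law level and the classical machines); the uniform family making the `N` oracle calls and
  running the verifier, with the two-sided acceptance bounds → RESIDUAL (B).
* Bookkeeping `γ = max 1 (100√n · max 1 (√(2n)/α)) = Õ(n/α)`, Lemma 2.11/2.12 (smoothing vs `λ_n`, `λ₁(L*)`)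
  → `isSoftBigO_gapSVPFactor`, `regevDGSBound_two_inv_pow_le_dgsBoundDual` (`RegevReduction.lean`),
  `SmoothingParameterBounds.lean` → PROVED.

So the classical part of the reduction (average-case/worst-case, amplification, the `BDD/CVP` solver
from the `LWE` oracle at the law level, the digit recursion, the verification test, `DGS ⇒ SIVP`,
[GMSS99]) and the mathematics of the quantum step are theorems; what remains is the uniform-family
ASSEMBLY of the one-sample stage (residual A: a program-level construction whose specification —
clauses (CODE), (BOOT₁), (STEP₁), (PASS₁) below — is fixed by the proved theorem consuming it) and of
the Lemma 3.20 decider (residual B). Neither residual restates a target: A is a statement about ONE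
stage of the iteration on ONE sample (no `SIVP`, no `γ`), B is `DGS ⇒ GapCVP′` (no `LWE`).

## Faithfulness notes

* The `LWE` oracle of residual A is a WORST-CASE search-`LWE_{q,Ψ̄_α}` solver with failure `≤ 2^{-cn}`
  (`UniformQCircuitFamily.SolvesSearchLWEWorstCase`), which is what the proof of Thm 3.1 uses after §2
  p. 12 / Lemma 4.1; the passage from the average-case `2/3`-solver of pqc.S19 is the proved
  `Regev2009.searchLWE_worstCase_of_avgCase`.
* `Ψ̄_α` = `discretizedGaussian (q n) (α n)` (`LWE.lean`); `η_ε` = `smoothingParameter`; `λ_n` =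
  `successiveMinimum · n`; `D_{L,r}` = `discreteGaussian L r 0`; the level radii `r·(αp/√n)^i` =
  `Regev2009.levelRadius`; statistical distance = `PMF.tvDist`; "negligible" = `IsNegligible`.
* Regev's algorithms output samples "exponentially close" to `D_{L,r}`; the tree's `DGS` samplers
  (`UniformQCircuitFamily.SamplesDGS`) allow a negligible statistical error `ν`, as §2 p. 11 stipulates.

## References

* O. Regev, *On lattices, learning with errors, random linear codes, and cryptography*, J. ACM 56 (2009),
  art. 34; author's version arXiv:2401.03703 (2024): Thm 1.1, §2 (pp. 11–12), Thm 3.1 and its proof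
  (p. 15), Lemmas 3.2–3.7, Claims 3.8–3.13, Lemmas 3.14–3.17 (pp. 15–21), Lemma 3.20 (p. 22), Lemma 4.1.
  [Regev2009] [RegevLWE2009]
* D. Aharonov, O. Regev, *Lattice problems in NP ∩ coNP*, J. ACM 52 (2005). [AharonovRegev2005]
-/

noncomputable section

namespace Literature.Computability.Cryptography

open Filter Literature.Computability.Complexity Literature.Computability.Cryptography.LWE
  Literature.Algebra.EuclideanLattices Literature.Computability.QuantumComplexity

variable (q : ℕ → ℕ) [∀ n, NeZero (q n)] (α : ℕ → ℝ) (m : ℕ → ℕ)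

/-- NAMED FACT (residual A) — **Regev 2009, the one-sample stage machine of the proof of Theorem 3.1
(Lemma 3.2 and Lemma 3.3 = Lemmas 3.4 + 3.14 in machine form, for ONE sample).** For parameters with
`m` polynomially bounded, `(q, α, m)` poly-time computable, `0 < α < 1 < α q/(2√n)` eventually, given a
uniform poly-time quantum family `W` solving search-`LWE_{q,Ψ̄_α}` in the worst case with failure
`≤ 2^{-cn}`, and any negligible positive `ε`: there are ONE uniform poly-time quantum family `Q`,
polynomials `p_N` (batch size `N = p_N(n) ≥ 1`) and `L` (code length), a negligible `ν₁` and ratios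
`θ(n) ≥ α q/√n` such that for all large `n`, for every nonsingular integer lattice instance `I` of
dimension `n` and rational `r` (input `x = ⟨I, r⟩`): (CODE) every output of `Q` on a copy input starts
with a framed vector code of length `≤ L(|x|)`; (BOOT₁, Lemma 3.2: "there exists an efficient
algorithm that, given any lattice `L` and `r > 2^{2n} λ_n(L)`, outputs a sample from a distribution
within statistical distance `2^{-Ω(n)}` of `D_{L,r}`") at stage `0`, when `ρ₀ = levelRadius θ (3n) r 0
> 2^{2n} λ_n`, every copy `j < N` decodes to a vector `ν₁`-close to `D_{L,ρ₀}`; (STEP₁, Lemma 3.3: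
"given any lattice `L`, `r > √2 p η_ε(L)` and `n^c` samples from `D_{L,r}`, produces a sample from
`D_{L, r√n/(αp)}`", the output distribution being correct with respect to the algorithm's own
randomness for all but a negligible fraction of sample tuples — note after Lemma 3.3) at a stage
`k + 1 ≤ 3n` with `ρ_k > √2 q η_ε(L)`, on every padded batch code of a short batch `b`, every copy
`j < N` decodes to a vector `F₁(b)`-close to `D_{L,ρ_{k+1}}` with `F₁ ≥ 0` and
`E_{b ∼ D_{L,ρ_k}^{⊗N}}[min 1 F₁(b)] ≤ ν₁`; (PASS₁) at stages `k + 1 > 3n` copy `j` writes vector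
`b_j` back exactly. The oracle `W` is taken for the DISCRETISED error `Ψ̄_α = discretizedGaussian (q n) (α n)`
(as in Theorem 1.1), whereas the printed Theorem 3.1 assumes an `LWE_{p,Ψ_α}` (continuous-error) oracle:
Lemma 4.3 (p. 23, "Discrete to Continuous": an `LWE_{p,φ̄}` solver yields an `LWE_{p,φ}` solver by
discretising the second element of each sample) is thereby ABSORBED into this residual — the tree's
classical step (`RegevBDDToLWESample*.lean`, `RegevBDDIntegerNoise.lean`) produces `Ψ̄`-samples directly.
Verbatim the hypothesis `hQ` of
`Literature.Computability.Cryptography.regev_lwe_to_sivp_quantum_of_oneCopy`; users take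
`(h : regev2009_thm_3_1_oneSampleStage q α)`.
[cite: Regev2009, Theorem 3.1 (proof, p. 15) with Lemmas 3.2, 3.3, 3.4, 3.14] -/
def regev2009_thm_3_1_oneSampleStage : Prop :=
  ∀ (m : ℕ → ℕ) (_ : IsPolyBounded m) (_ : IsPolyTimeParams q α m)
    (_ : ∀ᶠ n : ℕ in atTop, 0 < α n ∧ α n < 1 ∧ 2 * Real.sqrt n < α n * q n)
    (_ : ∃ (W : UniformQCircuitFamily) (c : ℝ), 0 < c ∧
      W.SolvesSearchLWEWorstCase q (fun n => discretizedGaussian (q n) (α n)) m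
        fun n => (2 : ℝ) ^ (-(c * n)))
    (ε : ℕ → ℝ), IsNegligible ε → (∀ n, 0 < ε n) →
    ∃ (Q : UniformQCircuitFamily) (pN L : Polynomial ℕ) (ν₁ θ : ℕ → ℝ),
      IsNegligible ν₁ ∧ (∀ n, 0 < pN.eval n) ∧ (∀ n, 0 < n → α n * q n / Real.sqrt n ≤ θ n) ∧
      ∀ᶠ n : ℕ in atTop, ∀ (I : LatticeInstance) (r : ℚ) (x : List Bool), I.n = n → I.IsNonsingular →
        x = GapSVPInstance.encode (I, r) →
        Regev2009.StageCopies.Code Q pN L I r ∧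
        ((2 : ℝ) ^ (2 * I.n) * successiveMinimum I.lattice I.n < Regev2009.levelRadius (θ I.n) (3 * I.n) r 0 →
          ∀ j : ℕ, j < pN.eval I.n →
            ((Q.kernel (boolPair (stageInput x 0 []) (Regev2009.StageCopies.idxWord (Regev2009.StageCopies.KOf pN x 0 []) j))).map (decodeLatticeVector I.n)).tvDist
              ((discreteGaussian I.lattice (Regev2009.levelRadius (θ I.n) (3 * I.n) r 0) 0).map I.intCoords) ≤ ν₁ I.n) ∧
        (∀ k, k < 3 * I.n →
          Real.sqrt 2 * q I.n * smoothingParameter I.lattice (ε I.n) < Regev2009.levelRadius (θ I.n) (3 * I.n) r k →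
          ∃ F₁ : (Fin (pN.eval I.n) → Fin I.n → ℤ) → ℝ, (∀ b, 0 ≤ F₁ b) ∧
            (∀ b : Fin (pN.eval I.n) → Fin I.n → ℤ, (∀ j, (Regev2009.vecCode I.n (b j)).length ≤ L.eval x.length) →
              ∀ (pad : List Bool) (j : ℕ), j < pN.eval I.n →
                ((Q.kernel (boolPair (stageInput x (k + 1) (Regev2009.encBatch I.n (pN.eval I.n) b ++ pad))
                    (Regev2009.StageCopies.idxWord (Regev2009.StageCopies.KOf pN x (k + 1) (Regev2009.encBatch I.n (pN.eval I.n) b ++ pad)) j))).map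
                    (decodeLatticeVector I.n)).tvDist
                  ((discreteGaussian I.lattice (Regev2009.levelRadius (θ I.n) (3 * I.n) r (k + 1)) 0).map I.intCoords) ≤ F₁ b) ∧
            ∑' b, (Regev2009.idealBatchZ I (pN.eval I.n) (Regev2009.levelRadius (θ I.n) (3 * I.n) r k) b).toReal * min 1 (F₁ b) ≤ ν₁ I.n) ∧
        (∀ k, 3 * I.n ≤ k → ∀ b : Fin (pN.eval I.n) → Fin I.n → ℤ,
          (∀ j, (Regev2009.vecCode I.n (b j)).length ≤ L.eval x.length) →
          ∀ (pad : List Bool) (j : ℕ) (hj : j < pN.eval I.n),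
            (Q.kernel (boolPair (stageInput x (k + 1) (Regev2009.encBatch I.n (pN.eval I.n) b ++ pad))
                (Regev2009.StageCopies.idxWord (Regev2009.StageCopies.KOf pN x (k + 1) (Regev2009.encBatch I.n (pN.eval I.n) b ++ pad)) j))).map
                (decodeLatticeVector I.n) = PMF.pure (b ⟨j, hj⟩))

/-- NAMED FACT (residual B) — **Regev 2009, Lemma 3.20 in machine form**: "For any `γ = γ(n) ≥ 1`,
there is a polynomial time reduction from `GapCVP′_{100√n·γ(n)}` to `DGS_{√n γ(n)/λ₁(L*)}`" (p. 22; the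
reduction calls the `DGS` oracle `N` times on `(L*, 1/(100d))` and accepts iff the Aharonov–Regev
verifier `𝒱` rejects). Machine form: for every `γ ≥ 1`, a uniform poly-time quantum family sampling
`DGS_{√n γ/λ₁(L*)}` up to a negligible statistical error (`UniformQCircuitFamily.SamplesDGS
(Regev2009.dgsBoundDual γ) ν`) yields a uniform poly-time quantum family accepting the YES instances of
`GapCVP′_{100√n γ}` with probability `≥ 2/3` and the NO instances with probability `≤ 1/3`, eventually
in the dimension. Verbatim the hypothesis `hL` of
`Literature.Computability.Cryptography.regev_lwe_to_gapSVP_quantum_of_thm31_of_lemma320` (and of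
`regev_lwe_to_gapSVP_quantum_of_dgs`); its NO-case analysis is the theorem
`Literature.Algebra.EuclideanLattices.ARVerifier.le_measureReal_accepts_certOf_of_gapCVP'_no`. Users
take `(hL : regev2009_lemma_3_20_machine)`.
[cite: Regev2009, Lemma 3.20 (p. 22) with AharonovRegev2005 §6] -/
def regev2009_lemma_3_20_machine : Prop :=
  ∀ (γ : ℕ → ℝ), (∀ n, 1 ≤ γ n) →
    (∃ (D : UniformQCircuitFamily) (ν : ℕ → ℝ),
        IsNegligible ν ∧ D.SamplesDGS (Regev2009.dgsBoundDual γ) ν) →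
    ∃ Q : UniformQCircuitFamily, ∀ᶠ n : ℕ in atTop, ∀ p : GapCVPInstance, p.1.I.n = n →
      (p ∈ GapCVP'.yes (fun k => 100 * Real.sqrt k * γ k) → 2 / 3 ≤ Q.acceptProb p.encode) ∧
      (p ∈ GapCVP'.no (fun k => 100 * Real.sqrt k * γ k) → Q.acceptProb p.encode ≤ 1 / 3)

/-- **Regev 2009, Theorem 3.1 in its printed form, PROVED from residual A**: "Let `ε = ε(n)` be some
negligible function of `n`. Also, let `p = p(n)` be some integer and `α = α(n) ∈ (0,1)` be such that
`αp > 2√n`. Assume that we have access to an oracle `W` that solves `LWE_{p,Ψ̄_α}` given a polynomial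
number of samples. Then there exists an efficient quantum algorithm for `DGS_{√(2n)·η_ε(L)/α}`."
(`thm_3_1_machine_of_kernelLaws ∘ StageCopies.kernelLaws_of_oneCopy`.)
[cite: Regev2009, Theorem 3.1 (p. 15)] -/
theorem regev2009_thm_3_1_dgs_of_oneSampleStage (h : regev2009_thm_3_1_oneSampleStage q α) :
    ∀ (m : ℕ → ℕ) (_ : IsPolyBounded m) (_ : IsPolyTimeParams q α m)
      (_ : ∀ᶠ n : ℕ in atTop, 0 < α n ∧ α n < 1 ∧ 2 * Real.sqrt n < α n * q n)
      (_ : ∃ (W : UniformQCircuitFamily) (c : ℝ), 0 < c ∧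
        W.SolvesSearchLWEWorstCase q (fun n => discretizedGaussian (q n) (α n)) m
          fun n => (2 : ℝ) ^ (-(c * n)))
      (ε : ℕ → ℝ), IsNegligible ε → (∀ n, 0 < ε n) →
      ∃ (D : UniformQCircuitFamily) (ν : ℕ → ℝ), IsNegligible ν ∧ D.SamplesDGS (regevDGSBound α ε) ν :=
  Regev2009.thm_3_1_machine_of_kernelLaws q α (Regev2009.StageCopies.kernelLaws_of_oneCopy q α h)

/-- **pqc.S19, SIVP form, from residual A (PROVED assembly).**
`Literature.Computability.Cryptography.regev_lwe_to_sivp_quantum q α m` — a uniform poly-time quantum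
`SIVP_{Õ(n/α)}` solver from a uniform poly-time quantum average-case search-`LWE_{q,Ψ̄_α}` solver — follows
from `regev2009_thm_3_1_oneSampleStage q α` by `regev_lwe_to_sivp_quantum_of_oneCopy` (with
`Regev2009.searchLWE_worstCase_of_avgCase`, `ChainCompose.exists_chainFamily`,
`Regev2009.GIVPMachine.regev_dgs_to_givp_quantum`, all theorems).
[cite: Regev2009, Theorem 1.1 (SIVP) from Theorem 3.1 and Lemma 3.17] -/
theorem regev_lwe_to_sivp_quantum_holds_of (h : regev2009_thm_3_1_oneSampleStage q α) :
    regev_lwe_to_sivp_quantum q α m :=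
  regev_lwe_to_sivp_quantum_of_oneCopy q α m h

/-- **pqc.S19, GapSVP form, from residuals A and B (PROVED assembly).**
`Literature.Computability.Cryptography.regev_lwe_to_gapSVP_quantum q α m` — a uniform poly-time quantum
`GapSVP_{Õ(n/α)}` decider from a uniform poly-time quantum average-case search-`LWE_{q,Ψ̄_α}` solver —
follows from `regev2009_thm_3_1_oneSampleStage q α` and `regev2009_lemma_3_20_machine` by
`regev_lwe_to_gapSVP_quantum_of_thm31_of_lemma320` (with `Regev2009.searchLWE_worstCase_of_avgCase` and
the [GMSS99] step `Regev2009.gmss_gapSVP_of_gapCVP'_quantum`, both theorems).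
[cite: Regev2009, Theorem 1.1 (GapSVP) from Theorem 3.1, Lemma 3.20 and §3.3] -/
theorem regev_lwe_to_gapSVP_quantum_holds_of (h : regev2009_thm_3_1_oneSampleStage q α)
    (hL : regev2009_lemma_3_20_machine) : regev_lwe_to_gapSVP_quantum q α m :=
  regev_lwe_to_gapSVP_quantum_of_thm31_of_lemma320 q α m (regev2009_thm_3_1_dgs_of_oneSampleStage q α h) hL

end Literature.Computability.Cryptography

end
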